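import Literature.Topology.FourManifolds.HomotopySpheresSumDimTwoLeaves
import HarnessLib

/-!
# Products in `Θₙ` exist: `HomotopySphereClass.isMul_exists` dimension by dimension

Topic `Literature/Topology/FourManifolds`, sibling proofs file of `HomotopySpheres.lean` for its
named fact `Literature.Topology.FourManifolds.HomotopySphereClass.isMul_exists` (Kervaire–Milnor,
*Groups of homotopy spheres I*, Ann. of Math. 77 (1963), §2, p. 505: oriented connected sums of
closed oriented manifolds exist — Kosinski, *Differential Manifolds* (1993), VI (1.1) — and
"It is clear that the sum of two homotopy `n`-spheres is a homotopy `n`-sphere"; so any two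
classes of `Θₙ = HomotopySphereClass n`, `n ≠ 0`, have a product `IsMul a b c`).  Everything
here is **proved**; no named fact is introduced.

## What the tree had, and what this file adds

`HomotopySpheresGroup.lean` reduces the fact (`HomotopySphereClass.isMul_exists_of`) to the
existence of oriented connected sums (the theorem `exists_isOrientedConnectedSum_holds`,
`OrientedConnectedSumExistence.lean`) and to the p. 505 remark
`HomotopySphere.nonempty_homotopyEquiv_sphere_of_isConnectedSum`, stated for ALL dimensions at
once; `HomotopySpheresSum.lean` reduces the remark (`…_of`) to the contractibility of punctured
homotopy spheres `HomotopySphere.contractibleSpace_compl_image_ball` (again all `n` at once), which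
the tree proves in dimensions `0`, `1` (`HomotopySpheresSumProofs.lean`,
`HomotopySpheresSumDimOne.lean`) and `n ≥ 3` (`HomotopySpheresSumENR.lean` with the proved Hurewicz
theorem `hurewicz_subsingleton_holds`), dimension `2` being reduced to `Θ₂ = 0`
(`nonemptyDiffeomorphSphere_two`) and further to one statement of Morse theory on surfaces
(`HomotopySpheresSumDimTwoLeaves.lean`).  Since the reduction of the remark uses the
contractibility only in the dimension at hand, the fact can be settled dimension by dimension:

* `HomotopySphere.nonempty_homotopyEquiv_sphere_of_isConnectedSum_of_dim` — the p. 505 remark in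
  dimension `n` from the contractibility of disc complements of homotopy `n`-spheres only
  (same suspension-like-cover argument, `ConnectedSumNeck.nonempty_homotopyEquiv_sphere`);
* `HomotopySphere.contractibleSpace_compl_image_ball_of_ne_two` — **unconditional** for `n ≠ 2`;
* `HomotopySphereClass.exists_isMul_of_dim`, `HomotopySphereClass.isMul_exists_of_ne_two` —
  **products exist in `Θₙ` for every `n ≠ 2`, unconditionally** (`isMul_exists_one`,
  `isMul_exists_of_three_le`);
* dimension `2`, the remaining case, from any ONE of the leaves recorded in
  `HomotopySpheresSumDimTwoLeaves.lean`: `Θ₂ = 0` (`isMul_exists_of_sphere_two`), Matsumoto's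
  Thm. 3.35 for surfaces (`…_of_niceMorse`), Milnor's Thm. 5.4 on a slab
  (`…_of_firstCancellation_slab`), Assertion 6 of its proof (`…_of_modelChart`); and, sharper,
  from the one input the ENR route of `HomotopySpheresSumENR.lean` lacks in dimension `2` —
  **the complement of a point in a homotopy `2`-sphere is simply connected**
  (`HomotopySphere.contractibleSpace_compl_image_ball_two_of_simplyConnected`,
  `isMul_exists_of_simplyConnected_compl_singleton_two`; path connectedness and acyclicity of
  the punctured homotopy `2`-sphere are theorems of `PuncturedHomotopySphere*.lean`).

So the trust base of `HomotopySphereClass.isMul_exists` is: nothing for `n ≠ 2`; for `n = 2`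
any one of `nonemptyDiffeomorphSphere_two`, `exists_isMorse_ncard_criticalSetOfIndex_eq_one 2`,
`Cobordism.Milnor1965_firstCancellation_slab`, `Cobordism.Milnor1965_cancellation_modelChart`, or
the simple connectivity of punctured homotopy `2`-spheres.

## References

* M. Kervaire, J. Milnor, *Groups of homotopy spheres I*, Ann. of Math. (2) 77 (1963), 504–537,
  §2 p. 505 (the remark and Lemma 2.1). doi:10.2307/1970128 [KervaireMilnorAnnals1963]
* A. Kosinski, *Differential Manifolds*, Academic Press (1993), Ch. VI §1 (1.1), §2 Prop. 2.1.
  [Kosinski1993]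
* A. Hatcher, *Algebraic Topology*, CUP (2002), Prop. 0.17, Thm. 4.32, Cor. A.9. [HatcherAT2002]
-/

open scoped Manifold ContDiff Topology ContinuousMap
open Set Function Metric Topology

noncomputable section

namespace Literature.Topology.FourManifolds

/-- Local notation: `𝔼 n` is the model Euclidean space `EuclideanSpace ℝ (Fin n)`. -/
local notation "𝔼 " n:arg => EuclideanSpace ℝ (Fin n)

/-- Local notation: `𝕊 n` is the unit sphere in `EuclideanSpace ℝ (Fin (n + 1))`, the standard
`n`-sphere with its Mathlib analytic manifold structure. -/
local notation "𝕊 " n:arg => (Metric.sphere (0 : EuclideanSpace ℝ (Fin (n + 1))) 1)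

namespace HomotopySphere

variable {n : ℕ}

/-! ### The p. 505 remark, one dimension at a time -/

/-- **The connected sum of two homotopy `n`-spheres is a homotopy `n`-sphere, given that disc
complements of homotopy `n`-spheres are contractible** — the reduction
`nonempty_homotopyEquiv_sphere_of_isConnectedSum_of` of `HomotopySpheresSum.lean` in the single
dimension `n`: unpack the gluing data of `IsConnectedSum` into a `ConnectedSumNeck` and apply
`ConnectedSumNeck.nonempty_homotopyEquiv_sphere` (suspension-like cover of `P` by the two disc
complements and the cylinder, Hatcher Prop. 0.17).  Kervaire–Milnor 1963, §2, p. 505: "It is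
clear that the sum of two homotopy `n`-spheres is a homotopy `n`-sphere". [cite: KervaireMilnorAnnals1963, §2 (p. 505)] -/
theorem nonempty_homotopyEquiv_sphere_of_isConnectedSum_of_dim
    (hK : ∀ (S : HomotopySphere n) (i : 𝔼 n → S.carrier),
      Manifold.IsSmoothEmbedding 𝓘(ℝ, 𝔼 n) (𝓡 n) ∞ i → ContractibleSpace ↥((i '' ball (0 : 𝔼 n) 1)ᶜ))
    (S T : HomotopySphere n) (P : Type*) [TopologicalSpace P] [T2Space P] [ChartedSpace (𝔼 n) P]
    (hP : IsConnectedSum (𝓡 n) (𝓡 n) (𝓡 n) S.carrier T.carrier P) : Nonempty (P ≃ₕ (𝕊 n)) := by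
  obtain ⟨i₁, i₂, hi₁, hi₂, jA, jB, hjA, hAo, hjB, hBo, hU, hR⟩ := hP
  let d : ConnectedSumNeck n S.carrier T.carrier P :=
    { i₁ := i₁
      i₂ := i₂
      jA := jA
      jB := jB
      continuous_i₁ := hi₁.isEmbedding.continuous
      injective_i₁ := hi₁.isEmbedding.injective
      continuous_i₂ := hi₂.isEmbedding.continuous
      injective_i₂ := hi₂.isEmbedding.injective
      isEmbedding_jA := hjA.isEmbedding
      isEmbedding_jB := hjB.isEmbedding
      isOpen_range_jA := hAo
      isOpen_range_jB := hBo
      union_range := hU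
      rel := hR }
  exact d.nonempty_homotopyEquiv_sphere (hK S i₁ hi₁) (hK T i₂ hi₂)

/-! ### Disc complements of homotopy spheres, `n ≠ 2` -/

/-- **A homotopy `n`-sphere with an open disc deleted is contractible, for every `n ≠ 2`**
(unconditionally): dimension `0` (`contractibleSpace_compl_image_ball_zero`), dimension `1`
(`contractibleSpace_compl_image_ball_one`, classification of compact `1`-manifolds by flows) and
dimensions `n ≥ 3` (`contractibleSpace_compl_image_ball_of_hurewicz_of_le`: simply connected and
acyclic, Hurewicz — `hurewicz_subsingleton_holds` — and the ENR form of Whitehead's theorem) are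
theorems of the tree.  Kosinski 1993, VI §1 (remark before Cor. 1.4); Kervaire–Milnor 1963,
proof of Lemma 2.4, p. 507. [cite: Kosinski1993, Ch. VI §1 (remark before Cor. 1.4)] [cite: KervaireMilnorAnnals1963, Lemma 2.4, proof (p. 507)] -/
theorem contractibleSpace_compl_image_ball_of_ne_two (hn2 : n ≠ 2) (S : HomotopySphere n)
    {i : 𝔼 n → S.carrier} (hi : Manifold.IsSmoothEmbedding 𝓘(ℝ, 𝔼 n) (𝓡 n) ∞ i) :
    ContractibleSpace ↥((i '' ball (0 : 𝔼 n) 1)ᶜ) := by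
  rcases Nat.lt_or_ge n 3 with hn | hn
  · interval_cases n
    · exact S.contractibleSpace_compl_image_ball_zero i
    · exact S.contractibleSpace_compl_image_ball_one hi
    · exact absurd rfl hn2
  · exact contractibleSpace_compl_image_ball_of_hurewicz_of_le
      Literature.AlgebraicTopology.SingularHomology.hurewicz_subsingleton_holds hn S hi

/-- **The sum of two homotopy `n`-spheres is a homotopy `n`-sphere, for every `n ≠ 2`**
(unconditionally; Kervaire–Milnor 1963, §2, p. 505). [cite: KervaireMilnorAnnals1963, §2 (p. 505)] -/
theorem nonempty_homotopyEquiv_sphere_of_isConnectedSum_of_ne_two (hn2 : n ≠ 2)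
    (S T : HomotopySphere n) (P : Type*) [TopologicalSpace P] [T2Space P] [ChartedSpace (𝔼 n) P]
    (hP : IsConnectedSum (𝓡 n) (𝓡 n) (𝓡 n) S.carrier T.carrier P) : Nonempty (P ≃ₕ (𝕊 n)) :=
  nonempty_homotopyEquiv_sphere_of_isConnectedSum_of_dim
    (fun S _ hi => S.contractibleSpace_compl_image_ball_of_ne_two hn2 hi) S T P hP

/-! ### Dimension `2`: the one missing input of the ENR route -/

/-- **A homotopy `2`-sphere with an open disc deleted is contractible, given that punctured
homotopy `2`-spheres are simply connected.**  The ENR route of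
`contractibleSpace_compl_image_ball_of_hurewicz_of_le` (`HomotopySpheresSumENR.lean`), run in
dimension `2`: the disc complement `Σ ∖ i(B)` is compact, path connected
(`isPathConnected_compl_image_ball`, `n ≥ 2`) and acyclic (`isZero_singularHomology_compl_image_ball`,
`n ≥ 2`); it is a deformation retract of `Σ ∖ {i 0}` (`BallComplement.homotopyEquiv`), so it is
simply connected by the hypothesis; hence all its homotopy groups vanish by the Hurewicz theorem
(`hurewicz_subsingleton_holds`, Hatcher Thm. 4.32) and, being a retract of an open subset of the
closed surface `Σ`, it is contractible (`contractibleSpace_of_retract_of_compactSpace_manifold`,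
Hatcher Cor. A.9 with Whitehead's theorem).  In dimension `2` only the simple connectivity of
`Σ ∖ {p}` is not a theorem of the tree (for `n ≥ 3` it is `simplyConnectedSpace_compl_singleton`;
for `n = 2` it is a consequence of `Θ₂ = 0`). [cite: Kosinski1993, Ch. VI §2 Prop. 2.1] [cite: HatcherAT2002, Thm. 4.32 and Appendix Cor. A.9] -/
theorem contractibleSpace_compl_image_ball_two_of_simplyConnected
    (hsc : ∀ (S : HomotopySphere 2) (p : S.carrier), SimplyConnectedSpace ↥(({p}ᶜ : Set S.carrier)))
    (S : HomotopySphere 2) {i : 𝔼 2 → S.carrier}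
    (hi : Manifold.IsSmoothEmbedding 𝓘(ℝ, 𝔼 2) (𝓡 2) ∞ i) :
    ContractibleSpace ↥((i '' ball (0 : 𝔼 2) 1)ᶜ) := by
  have hio : IsOpenEmbedding i := isOpenEmbedding_of_isSmoothEmbedding_euclidean hi
  have hU : IsOpen ({i 0}ᶜ : Set S.carrier) := isOpen_compl_singleton
  have hAU : (i '' ball (0 : 𝔼 2) 1)ᶜ ⊆ ({i 0}ᶜ : Set S.carrier) :=
    Literature.AlgebraicTopology.Homotopy.BallComplement.compl_image_ball_subset
  have hA : IsCompact (i '' ball (0 : 𝔼 2) 1)ᶜ :=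
    (hio.isOpenMap _ isOpen_ball).isClosed_compl.isCompact
  have hpc := S.isPathConnected_compl_image_ball le_rfl hi
  haveI : PathConnectedSpace ↥((i '' ball (0 : 𝔼 2) 1)ᶜ) :=
    isPathConnected_iff_pathConnectedSpace.1 hpc
  haveI := hsc S (i 0)
  haveI : SimplyConnectedSpace ↥((i '' ball (0 : 𝔼 2) 1)ᶜ) :=
    (Literature.AlgebraicTopology.Homotopy.BallComplement.homotopyEquiv hio).simplyConnectedSpace
  have hπ := Literature.AlgebraicTopology.SingularHomology.subsingleton_homotopyGroup_of_isZero_singularHomology_of_subsingleton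
    Literature.AlgebraicTopology.SingularHomology.hurewicz_subsingleton_holds
    (X := ↥((i '' ball (0 : 𝔼 2) 1)ᶜ))
    fun k hk => S.isZero_singularHomology_compl_image_ball le_rfl hi hk
  let y₀ : ↥((i '' ball (0 : 𝔼 2) 1)ᶜ) := Classical.arbitrary _
  exact contractibleSpace_of_retract_of_compactSpace_manifold (I := 𝓡 2) hU hA hAU
    (Literature.AlgebraicTopology.Homotopy.BallComplement.retr hio)
    (fun x hx => Literature.AlgebraicTopology.Homotopy.BallComplement.retrFun_incl hio.isEmbedding ⟨x, hx⟩)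
    y₀ fun k hk => hπ k hk y₀

/-- **Punctured homotopy spheres are contractible (all `n`), given that punctured homotopy
`2`-spheres are simply connected**: the named fact `contractibleSpace_compl_image_ball` from that
single input (`contractibleSpace_compl_image_ball_of_ne_two` and
`contractibleSpace_compl_image_ball_two_of_simplyConnected`). [cite: Kosinski1993, Ch. VI §1 (remark before Cor. 1.4)] -/
theorem contractibleSpace_compl_image_ball_of_simplyConnected_two
    (hsc : ∀ (S : HomotopySphere 2) (p : S.carrier), SimplyConnectedSpace ↥(({p}ᶜ : Set S.carrier))) :
    contractibleSpace_compl_image_ball := by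
  intro n S i hi
  by_cases hn2 : n = 2
  · subst hn2
    exact contractibleSpace_compl_image_ball_two_of_simplyConnected hsc S hi
  · exact S.contractibleSpace_compl_image_ball_of_ne_two hn2 hi

end HomotopySphere

/-! ### Products in `Θₙ` -/

namespace HomotopySphereClass

variable {n : ℕ}

/-- **Products exist in `Θₙ` (`n ≠ 0`), given the contractibility of disc complements of homotopy
`n`-spheres in that dimension only**: take representatives, form their oriented connected sum
(`exists_isOrientedConnectedSum_holds`, Kosinski VI (1.1)) and take its class, the sum being a
homotopy sphere by `HomotopySphere.nonempty_homotopyEquiv_sphere_of_isConnectedSum_of_dim`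
(Kervaire–Milnor 1963, §2, p. 505).  Dimension-wise form of `exists_isMul_of`. [cite: KervaireMilnorAnnals1963, §2 p. 505] -/
theorem exists_isMul_of_dim
    (hK : ∀ (S : HomotopySphere n) (i : 𝔼 n → S.carrier),
      Manifold.IsSmoothEmbedding 𝓘(ℝ, 𝔼 n) (𝓡 n) ∞ i → ContractibleSpace ↥((i '' ball (0 : 𝔼 n) 1)ᶜ))
    (hn : n ≠ 0) (a b : HomotopySphereClass n) : ∃ c, IsMul a b c := by
  induction a using HomotopySphereClass.ind with
  | h S =>
    induction b using HomotopySphereClass.ind with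
    | h T =>
      haveI := S.nonempty
      haveI := T.nonempty
      obtain ⟨P, _, _, _, _, _, _, oP, hP⟩ :=
        exists_isOrientedConnectedSum_holds hn S.carrier T.carrier S.orientation T.orientation
      obtain ⟨e⟩ := HomotopySphere.nonempty_homotopyEquiv_sphere_of_isConnectedSum_of_dim hK S T P
        hP.isConnectedSum
      exact ⟨mk ⟨P, oP, ⟨e⟩⟩, S, T, ⟨P, oP, ⟨e⟩⟩, rfl, rfl, rfl, hP⟩

/-- **Products exist in `Θₙ` for every `n ≠ 2`, unconditionally** (`isMul_exists` for `n ≠ 2`;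
Kervaire–Milnor 1963, §2, p. 505 with Kosinski VI (1.1)). [cite: KervaireMilnorAnnals1963, §2 p. 505] -/
theorem isMul_exists_of_ne_two (hn2 : n ≠ 2) : isMul_exists (n := n) := fun hn a b =>
  exists_isMul_of_dim (fun S _ hi => S.contractibleSpace_compl_image_ball_of_ne_two hn2 hi) hn a b

/-- **Products exist in `Θ₁`** (unconditionally). [cite: KervaireMilnorAnnals1963, §2 p. 505] -/
theorem isMul_exists_one : isMul_exists (n := 1) :=
  isMul_exists_of_ne_two (by decide)

/-- **Products exist in `Θₙ` for `n ≥ 3`** (unconditionally) — the dimensions of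
Kervaire–Milnor's Theorem 1.2 and of the groups `bPₙ₊₁`. [cite: KervaireMilnorAnnals1963, §2 p. 505] -/
theorem isMul_exists_of_three_le (h3 : 3 ≤ n) : isMul_exists (n := n) :=
  isMul_exists_of_ne_two (by omega)

/-- `isMul_exists` (all `n`) from the contractibility of punctured homotopy spheres
(`HomotopySphere.contractibleSpace_compl_image_ball`), the existence of oriented connected sums
being the theorem `exists_isOrientedConnectedSum_holds`. [cite: KervaireMilnorAnnals1963, §2 p. 505] -/
theorem isMul_exists_of_contractibleSpace_compl_image_ball
    (hK : HomotopySphere.contractibleSpace_compl_image_ball) : isMul_exists (n := n) :=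
  fun hn a b => exists_isMul_of_dim (fun S i hi => hK n S i hi) hn a b

/-- **`isMul_exists` (all `n`) from `Θ₂ = 0` alone** (`nonemptyDiffeomorphSphere_two`: every
smooth surface homotopy equivalent to `S²` is diffeomorphic to it; Kervaire–Milnor 1963, p. 507),
through `HomotopySphere.contractibleSpace_compl_image_ball_of_sphere_two`. [cite: KervaireMilnorAnnals1963, §2 pp. 505, 507] -/
theorem isMul_exists_of_sphere_two (h2 : nonemptyDiffeomorphSphere_two.{0}) : isMul_exists (n := n) :=
  isMul_exists_of_contractibleSpace_compl_image_ball
    (HomotopySphere.contractibleSpace_compl_image_ball_of_sphere_two h2)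

/-- **`isMul_exists` (all `n`) from Matsumoto's Thm. 3.35 in dimension `2`** (one minimum and one
maximum on every closed connected surface, `exists_isMorse_ncard_criticalSetOfIndex_eq_one 2`),
through `HomotopySphere.contractibleSpace_compl_image_ball_of_niceMorse`. [cite: KervaireMilnorAnnals1963, §2 p. 505] [cite: Matsumoto2001, Thm. 3.35] -/
theorem isMul_exists_of_niceMorse (hU : exists_isMorse_ncard_criticalSetOfIndex_eq_one.{0} 2) :
    isMul_exists (n := n) :=
  isMul_exists_of_contractibleSpace_compl_image_ball
    (HomotopySphere.contractibleSpace_compl_image_ball_of_niceMorse hU)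

/-- **`isMul_exists` (all `n`) from Milnor's First Cancellation Theorem 5.4 on a slab**
(`Cobordism.Milnor1965_firstCancellation_slab`), through
`HomotopySphere.contractibleSpace_compl_image_ball_of_firstCancellation_slab`. [cite: KervaireMilnorAnnals1963, §2 p. 505] [cite: MilnorHCobordism1965, Thm. 5.4] -/
theorem isMul_exists_of_firstCancellation_slab (h54 : Cobordism.Milnor1965_firstCancellation_slab.{0}) :
    isMul_exists (n := n) :=
  isMul_exists_of_contractibleSpace_compl_image_ball
    (HomotopySphere.contractibleSpace_compl_image_ball_of_firstCancellation_slab h54)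

/-- **`isMul_exists` (all `n`) from Assertion 6 of the proof of Milnor's Thm. 5.4**
(`Cobordism.Milnor1965_cancellation_modelChart`), through
`HomotopySphere.contractibleSpace_compl_image_ball_of_modelChart`. [cite: KervaireMilnorAnnals1963, §2 p. 505] [cite: MilnorHCobordism1965, proof of Thm. 5.4, Assertion 6] -/
theorem isMul_exists_of_modelChart (hE : Cobordism.Milnor1965_cancellation_modelChart.{0}) :
    isMul_exists (n := n) :=
  isMul_exists_of_contractibleSpace_compl_image_ball
    (HomotopySphere.contractibleSpace_compl_image_ball_of_modelChart hE)

/-- **`isMul_exists` (all `n`) from the simple connectivity of punctured homotopy `2`-spheres** —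
the one input the ENR route lacks in dimension `2`
(`HomotopySphere.contractibleSpace_compl_image_ball_of_simplyConnected_two`). [cite: KervaireMilnorAnnals1963, §2 p. 505] -/
theorem isMul_exists_of_simplyConnected_compl_singleton_two
    (hsc : ∀ (S : HomotopySphere 2) (p : S.carrier), SimplyConnectedSpace ↥(({p}ᶜ : Set S.carrier))) :
    isMul_exists (n := n) :=
  isMul_exists_of_contractibleSpace_compl_image_ball
    (HomotopySphere.contractibleSpace_compl_image_ball_of_simplyConnected_two hsc)

end HomotopySphereClass

end Literature.Topology.FourManifolds
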